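import Literature.Barriers.CriticalPhenomena.RigorousRGSmallParameterLocProperties
import Literature.Barriers.CriticalPhenomena.RigorousRGSmallParameterLocTranslation
import HarnessLib

/-!
# `RigorousRGSmallParameter` (Slade, Theorem 1.4.1): Euclidean covariance of the localisation
# operator — Propositions 1.4.3 and 1.4.4 of [BS-rg-loc] for the automorphisms fixing a point

Companion ("proof architecture") file of
`Literature/Barriers/CriticalPhenomena/RigorousRGSmallParameter.lean`, completing the algebraic
theory of `Loc_X` ([BS-rg-loc] §1.2–1.4) begun in `…LocalMonomials` … `…LocTranslation`.
[BS-rg-loc]: an automorphism `E` of the torus acts on `𝒩` by `(EF)(φ) = F(φ_E)`; the subgroup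
fixing the origin "is homomorphic to the group `Σ = Σ_axes ⋊ Σ_+`" of signed permutations of the
axes; the symmetrised monomials `P̂(M)` are `Σ_axes`-covariant and `Σ_+`-equivariant
(Definition 1.2.2 (i),(iii)); **Proposition 1.4.3**: `E(Loc_X F) = Loc_{EX}(EF)`;
**Proposition 1.4.4**: if `EF = F` for all `E ∈ ℰ(X)` then `P` with `P(X) = Loc_X F` obeys
`Θ_E P = P`. This file proves these for the concrete model on the torus `TorusSite d M`, for the
automorphisms `E = E_Θ : y ↦ a + Θ(y - a)` fixing the base point `a` (`Θ` a signed permutation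
of the axes; together with `…LocTranslation` this covers `ℰ(Λ) = translations ⋊ Σ`):

* a general tool: the **coefficients of `F ∘ T` for a continuous linear map `T` of the field**
  (`coeff_comp_clm`, multilinearity of `D^pF`) and the pairing covariance
  `⟨F ∘ T, g⟩_0 = ⟨F, T_*g⟩_0` (`TphiPairing_comp_clm_zero`); for `T` permuting the coordinate
  directions, `T_*g = g ∘ π⁻¹` (`TphiPairing_comp_labelPerm_zero`) — the display
  `⟨EF,g⟩_φ = ⟨F,E^*g⟩_{φ_E}` of the proof of Proposition 1.4.3;
* `AxisSym` (`Θ`), `E_Θ` (`AxisSym.pt`, a permutation `ptEquiv` of the torus), its action on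
  fields (`fieldMap`), unit steps (`vec_unitStep`), monomials (**`monomial_comp_fieldMap`**:
  `E M_{m,x} = M_{Θm,Ex}`) and **`phat_comp_fieldMap`**: `E P̂_{m,x} = λ(Θ,m) P̂_{πm,Ex}` with
  `λ = (-1)^{#derivatives along reversed axes}` (the sign bookkeeping `S ↦ πS Δ N` in the flip
  average; Definition 1.2.2 (i),(iii));
* coordinates and binomial test functions under `E_Θ` (`coord_pt`; `binom(-z,t)` in the binomial
  basis, `choose_neg_eq_sum`, from `Ring.choose_neg` and Chu–Vandermonde), `E^*f_C^{(a)}` as a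
  product of expandable factors (`axisFactor`, `dualC_comp_labelPerm`) and the span stability
  `TphiPairing_dualC_axis_eq_zero` ("`E^*` maps test functions in `Π[EΛ']` to test functions in
  `Π[Λ']`");
* `P̂` depends on the index sequence only through its classes (`phat_congr`), relabelled classes
  (`relabelCls`, `relabelV : 𝔳_+ ≃ 𝔳_+`), and finally **`locX_comp_fieldMap`**
  (Proposition 1.4.3) and **`betaVec_relabel_of_invariant`** (Proposition 1.4.4:
  `β_{πC} = λ_C β_C` for `E`-invariant `F` and `X`).

Sources: D. C. Brydges, G. Slade, *A renormalisation group method. II. Approximation by local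
polynomials*, J. Stat. Phys. 159 (2015) 461–491, arXiv:1403.7253 (read from the TeX source: §1.2
(`Σ`, `P(M)`, Definition 1.2.2, Proposition 1.2.4), §1.4 (action of `E` on `𝒩`, Propositions
1.4.3–1.4.4 with proofs), §2.3 (Lemma 2.3.1)); G. Slade, arXiv:1611.06169, §4.2 and
Definition 3.4.2 ("symmetry considerations preclude …").

## What this file provides (definitions with proved properties; no named fact)

* `clmCoord`, `clm_basisDir_eq_sum`, `dirDeriv_comp_clm`, **`coeff_comp_clm`**, `pushTF`,
  **`TphiPairing_comp_clm_zero`**, `IsLabelPerm`, `clmCoord_of_isLabelPerm`,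
  `prod_zipWith_indicator`, `pushTF_of_isLabelPerm`, **`TphiPairing_comp_labelPerm_zero`**.
* `AxisSym` with `vec`, `inv`, `pt`, `ptEquiv`, `step`, `vec_unitStep`, `onIdx`, `fieldMap`,
  `labelPerm`, `isLabelPerm_fieldMap`, `dfield_fieldMap`, **`monomial_comp_fieldMap`**, `relabel`,
  `relabelF`, `onIdx_flipM`, `sgnB_flipL_fwd`, `sgnM_flipM_fwd`, `sgnM_flipM_symmDiff`,
  `sgnM_flipM_relabel`, **`phat_comp_fieldMap`**, `coord_pt`, `axisFactor`, `axisFactor_valid`,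
  `wtq_axisFactor`, `dualC_comp_labelPerm`, **`TphiPairing_dualC_axis_eq_zero`**,
  `phatX_rep_comp_fieldMap`, **`locX_comp_fieldMap`**, **`betaVec_relabel_of_invariant`**.
* `two_mul_val_ne_of_abs_lt`, `choose_neg_eq_sum`, `signCoef`, `choose_sign_eq_sum`,
  `tensorTF_map`, `sclass`, `monomial_congr_sclass`, `sgnM_congr_sclass`, `map_sclass_flipM_fwd`,
  **`phat_congr`**, `phatX_congr`, `relabelCls`, `map_cls_relabelF`, `relabelCls_symm_apply`,
  `dim_relabelF`, `relabelCls_mem_vPlus`, `relabelV`, `phatX_relabelF_rep`.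

## References

* [BrydgesSlade2015RGII] D. C. Brydges, G. Slade, *A renormalisation group method. II.
  Approximation by local polynomials*, J. Stat. Phys. 159 (2015) 461–491, arXiv:1403.7253 —
  §1.2, §1.4 (Propositions 1.4.3, 1.4.4), §2.3.
* [Slade2017] G. Slade, *Critical exponents for long-range O(n) models below the upper critical
  dimension*, Commun. Math. Phys. 358 (2018) 343–436, arXiv:1611.06169 — §4.2, Definition 3.4.2.
-/

noncomputable section

namespace Literature.Barriers.CriticalPhenomena

namespace LongRangePhi4

namespace Loc

open Finset Tphi RGNorm LocalPoly Polymer Literature.Probability.LatticeModels Matrix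
open scoped ContDiff

variable {d M n : ℕ} [NeZero M]

/-! ### Coefficients of `F ∘ T` for a linear map `T` of the field (multilinear chain rule) -/

/-- The matrix of `T` in the coordinate directions: `T e_ξ = Σ_η c_{ηξ} e_η`. [folklore] -/
def clmCoord (T : (TorusSite d M → Fin n → ℝ) →L[ℝ] (TorusSite d M → Fin n → ℝ)) (η ξ : TorusSite d M × Fin n) : ℝ :=
  T (basisDir d M n ξ) η.1 η.2

/-- `T e_ξ = Σ_η c_{ηξ} e_η`. [folklore] -/
theorem clm_basisDir_eq_sum (T : (TorusSite d M → Fin n → ℝ) →L[ℝ] (TorusSite d M → Fin n → ℝ)) (ξ : TorusSite d M × Fin n) :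
    T (basisDir d M n ξ) = ∑ η, clmCoord T η ξ • basisDir d M n η :=
  (sum_fieldFn_smul_basisDir (T (basisDir d M n ξ))).symm

/-- **`∂_{e_ξ}(F ∘ T) = Σ_η c_{ηξ} (∂_{e_η}F) ∘ T`.** [folklore] -/
theorem dirDeriv_comp_clm (T : (TorusSite d M → Fin n → ℝ) →L[ℝ] (TorusSite d M → Fin n → ℝ))
    {F : (TorusSite d M → Fin n → ℝ) → ℝ} (hF : Differentiable ℝ F) (ξ : TorusSite d M × Fin n) :
    Tphi.dirDeriv (basisDir d M n ξ) (fun φ => F (T φ)) =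
      fun φ => ∑ η, clmCoord T η ξ * Tphi.dirDeriv (basisDir d M n η) F (T φ) := by
  funext φ
  unfold Tphi.dirDeriv
  have h : HasFDerivAt (fun ψ => F (T ψ)) ((fderiv ℝ F (T φ)).comp T) φ :=
    (hF (T φ)).hasFDerivAt.comp φ T.hasFDerivAt
  rw [h.fderiv, ContinuousLinearMap.comp_apply, clm_basisDir_eq_sum, map_sum]
  simp only [map_smul, smul_eq_mul]

/-- **The coefficients of `F ∘ T`**:
`(F ∘ T)_{ξ_1⋯ξ_p}(φ) = Σ_{η_1⋯η_p} (∏_k c_{η_kξ_k}) F_{η_1⋯η_p}(Tφ)` (multilinearity of `D^pF`).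
[folklore] -/
theorem coeff_comp_clm (T : (TorusSite d M → Fin n → ℝ) →L[ℝ] (TorusSite d M → Fin n → ℝ))
    {F : (TorusSite d M → Fin n → ℝ) → ℝ} (hF : ContDiff ℝ ∞ F) :
    ∀ (z : List (TorusSite d M × Fin n)) (φ : TorusSite d M → Fin n → ℝ),
      coeff (basisDir d M n) z (fun ψ => F (T ψ)) φ =
        sumSeq z.length (fun w => (List.zipWith (clmCoord T) w z).prod * coeff (basisDir d M n) w F (T φ))
  | [], φ => by simp
  | ξ :: z, φ => by
      rw [coeff_cons, List.length_cons, sumSeq_succ]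
      have hfun : coeff (basisDir d M n) z (fun ψ => F (T ψ)) =
          fun φ => ∑ v : Fin z.length → TorusSite d M × Fin n,
            (List.zipWith (clmCoord T) (List.ofFn v) z).prod * coeff (basisDir d M n) (List.ofFn v) F (T φ) := by
        funext φ'
        rw [coeff_comp_clm T hF z φ', sumSeq_eq_sum_fn]
      have hdiffw : ∀ w : List (TorusSite d M × Fin n), Differentiable ℝ (fun φ => coeff (basisDir d M n) w F (T φ)) :=
        fun w => (differentiable_of_contDiff (contDiff_coeff _ hF w)).comp T.differentiable
      rw [hfun, dirDeriv_finset_sum _ _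
        (F := fun v φ => (List.zipWith (clmCoord T) (List.ofFn v) z).prod * coeff (basisDir d M n) (List.ofFn v) F (T φ))
        (fun v _ => (hdiffw _).const_mul _)]
      simp only [dirDeriv_const_mul _ _ (hdiffw _)]
      have hd : ∀ w : List (TorusSite d M × Fin n), Tphi.dirDeriv (basisDir d M n ξ) (fun φ => coeff (basisDir d M n) w F (T φ)) φ =
          ∑ η, clmCoord T η ξ * coeff (basisDir d M n) (η :: w) F (T φ) := by
        intro w
        rw [dirDeriv_comp_clm T (differentiable_of_contDiff (contDiff_coeff _ hF w)) ξ]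
        rfl
      simp only [hd, Finset.mul_sum]
      rw [Finset.sum_comm]
      refine Finset.sum_congr rfl fun η _ => ?_
      rw [sumSeq_eq_sum_fn]
      refine Finset.sum_congr rfl fun v _ => ?_
      simp only [List.zipWith_cons_cons, List.prod_cons]
      ring

/-- **The push-forward of a test function by `T`**: `(T_*g)_w = Σ_z (∏_k c_{w_kz_k}) g_z`. [folklore] -/
def pushTF (T : (TorusSite d M → Fin n → ℝ) →L[ℝ] (TorusSite d M → Fin n → ℝ)) (g : List (TorusSite d M × Fin n) → ℝ) :
    List (TorusSite d M × Fin n) → ℝ :=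
  fun w => sumSeq w.length (fun z => (List.zipWith (clmCoord T) w z).prod * g z)

/-- **Pairing covariance**: `⟨F ∘ T, g⟩_0 = ⟨F, T_*g⟩_0` for a continuous linear `T` (the
display `⟨EF, g⟩_φ = ⟨F, E^*g⟩_{φ_E}` of [BS-rg-loc], at `φ = 0`). [cite: BrydgesSlade2015RGII, Proposition 1.4.3 (proof)] -/
theorem TphiPairing_comp_clm_zero (pN : ℕ) (T : (TorusSite d M → Fin n → ℝ) →L[ℝ] (TorusSite d M → Fin n → ℝ))
    {F : (TorusSite d M → Fin n → ℝ) → ℝ} (hF : ContDiff ℝ ∞ F) (g : List (TorusSite d M × Fin n) → ℝ) :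
    TphiPairing pN (basisDir d M n) (fun ψ => F (T ψ)) 0 g = TphiPairing pN (basisDir d M n) F 0 (pushTF T g) := by
  unfold TphiPairing pairing
  refine Finset.sum_congr rfl fun r _ => ?_
  congr 1
  simp only [coeffFamily, coeff_comp_clm T hF, map_zero, pushTF]
  -- swap the two sums over sequences of length `r`
  have h1 : sumSeq r (fun z => sumSeq z.length (fun w => (List.zipWith (clmCoord T) w z).prod * coeff (basisDir d M n) w F 0) * g z) =
      sumSeq r (fun z => sumSeq r (fun w => (List.zipWith (clmCoord T) w z).prod * coeff (basisDir d M n) w F 0 * g z)) := by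
    refine sumSeq_congr r fun z hz => ?_
    rw [hz, mul_comm, ← sumSeq_mul_left]
    exact sumSeq_congr r fun w _ => by ring
  have h2 : sumSeq r (fun w => coeff (basisDir d M n) w F 0 * sumSeq w.length (fun z => (List.zipWith (clmCoord T) w z).prod * g z)) =
      sumSeq r (fun w => sumSeq r (fun z => (List.zipWith (clmCoord T) w z).prod * coeff (basisDir d M n) w F 0 * g z)) := by
    refine sumSeq_congr r fun w hw => ?_
    rw [hw, ← sumSeq_mul_left]
    exact sumSeq_congr r fun z _ => by ring
  rw [h1, h2, sumSeq_sumSeq_comm]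

/-! ### Label permutations: `T e_ξ = e_{πξ}` -/

/-- A field map permuting the coordinate directions: `T e_ξ = e_{π ξ}`. [folklore] -/
def IsLabelPerm (T : (TorusSite d M → Fin n → ℝ) →L[ℝ] (TorusSite d M → Fin n → ℝ))
    (π : TorusSite d M × Fin n ≃ TorusSite d M × Fin n) : Prop :=
  ∀ ξ, T (basisDir d M n ξ) = basisDir d M n (π ξ)

omit [NeZero M] in
/-- For a label permutation, `c_{ηξ} = 𝟙{η = πξ}`. [folklore] -/
theorem clmCoord_of_isLabelPerm {T : (TorusSite d M → Fin n → ℝ) →L[ℝ] (TorusSite d M → Fin n → ℝ)}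
    {π : TorusSite d M × Fin n ≃ TorusSite d M × Fin n} (hT : IsLabelPerm T π) (η ξ : TorusSite d M × Fin n) :
    clmCoord T η ξ = if η = π ξ then 1 else 0 := by
  unfold clmCoord
  rw [hT ξ, basisDir_apply]
  by_cases h : η = π ξ
  · rw [if_pos h, if_pos ⟨congrArg Prod.fst h, congrArg Prod.snd h⟩]
  · rw [if_neg h, if_neg]
    rintro ⟨h1, h2⟩
    exact h (Prod.ext h1 h2)

omit [NeZero M] in
/-- The indicator product `∏_k 𝟙{w_k = π z_k}` is `𝟙{w = πz}` for sequences of equal length. [folklore] -/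
theorem prod_zipWith_indicator {π : TorusSite d M × Fin n ≃ TorusSite d M × Fin n} :
    ∀ (w z : List (TorusSite d M × Fin n)), w.length = z.length →
    (List.zipWith (fun η ξ => if η = π ξ then (1 : ℝ) else 0) w z).prod = if w = z.map π then 1 else 0
  | [], [], _ => by simp
  | [], _ :: _, h => by simp at h
  | _ :: _, [], h => by simp at h
  | η :: w, ξ :: z, h => by
      rw [List.zipWith_cons_cons, List.prod_cons, prod_zipWith_indicator w z (by simpa using h), List.map_cons]
      by_cases h1 : η = π ξ <;> by_cases h2 : w = z.map π <;> simp [h1, h2]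

/-- **For a label permutation, `T_*g = g ∘ π⁻¹`** (on sequences: `(T_*g)_w = g_{π⁻¹w}`). [folklore] -/
theorem pushTF_of_isLabelPerm {T : (TorusSite d M → Fin n → ℝ) →L[ℝ] (TorusSite d M → Fin n → ℝ)}
    {π : TorusSite d M × Fin n ≃ TorusSite d M × Fin n} (hT : IsLabelPerm T π) (g : List (TorusSite d M × Fin n) → ℝ) :
    pushTF T g = fun w => g (w.map π.symm) := by
  funext w
  unfold pushTF
  have hc : clmCoord T = fun η ξ => if η = π ξ then (1 : ℝ) else 0 :=
    funext fun η => funext fun ξ => clmCoord_of_isLabelPerm hT η ξ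
  rw [hc]
  rw [sumSeq_congr w.length (g := fun z => (if w = z.map π then 1 else 0) * g z)
    (fun z hz => by rw [prod_zipWith_indicator w z hz.symm]), sumSeq_eq_sum_fn]
  rw [Finset.sum_eq_single (fun k => π.symm (w.get k))]
  · have hmap : w.map π.symm = List.ofFn fun k => π.symm (w.get k) := by
      conv_lhs => rw [← List.ofFn_get w]
      rw [List.map_ofFn]
      rfl
    have hw : w = (List.ofFn fun k => π.symm (w.get k)).map π := by
      rw [← hmap, List.map_map]
      simp
    rw [if_pos hw, one_mul, hmap]
  · intro v _ hv
    rw [if_neg, zero_mul]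
    intro h
    apply hv
    funext k
    have hk : w.get k = π (v k) := by
      have h2 : ∀ (k : Fin w.length), w.get k = ((List.ofFn v).map π).get ⟨k, by simp⟩ := by
        intro k
        exact List.get_of_eq h _
      rw [h2 k]
      simp
    rw [hk]; simp
  · intro h; exact absurd (Finset.mem_univ _) h

/-- **Pairing covariance for label permutations**: `⟨F ∘ T, g⟩_0 = ⟨F, g ∘ π⁻¹⟩_0`. [folklore] -/
theorem TphiPairing_comp_labelPerm_zero (pN : ℕ) {T : (TorusSite d M → Fin n → ℝ) →L[ℝ] (TorusSite d M → Fin n → ℝ)}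
    {π : TorusSite d M × Fin n ≃ TorusSite d M × Fin n} (hT : IsLabelPerm T π)
    {F : (TorusSite d M → Fin n → ℝ) → ℝ} (hF : ContDiff ℝ ∞ F) (g : List (TorusSite d M × Fin n) → ℝ) :
    TphiPairing pN (basisDir d M n) (fun ψ => F (T ψ)) 0 g =
      TphiPairing pN (basisDir d M n) F 0 (fun w => g (w.map π.symm)) := by
  rw [TphiPairing_comp_clm_zero pN T hF g, pushTF_of_isLabelPerm hT]

/-! ### Automorphisms of the torus fixing a point: signed permutations of the axes -/

/-- A signed permutation of the axes: `Θ ∈ Σ = Σ_axes ⋊ Σ_+` of [BS-rg-loc] (permute the axes by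
`perm`, then reverse the axes in `neg`). [cite: BrydgesSlade2015RGII, §1.2 ("Σ is the semidirect product Σ_axes ⋊ Σ_+")] -/
structure AxisSym (d : ℕ) where
  /-- the permutation of the axes -/
  perm : Equiv.Perm (Fin d)
  /-- the reversed axes (in the target labelling) -/
  neg : Finset (Fin d)

namespace AxisSym

variable (Θ : AxisSym d)

/-- The linear action on lattice vectors: `(Θu)_j = ±u_{π⁻¹j}`. [folklore] -/
def vec (u : TorusSite d M) : TorusSite d M := fun j => (if j ∈ Θ.neg then -1 else 1) * u (Θ.perm.symm j)

/-- The inverse signed permutation. [folklore] -/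
def inv : AxisSym d := ⟨Θ.perm.symm, Θ.neg.map Θ.perm.symm.toEmbedding⟩

omit [NeZero M] in
/-- `Θ` is additive on vectors. [folklore] -/
theorem vec_add (u u' : TorusSite d M) : Θ.vec (u + u') = Θ.vec u + Θ.vec u' := by
  funext j; simp [vec, mul_add]

omit [NeZero M] in
/-- `Θ` maps `0` to `0`. [folklore] -/
@[simp] theorem vec_zero : Θ.vec (0 : TorusSite d M) = 0 := by
  funext j; simp [vec]

omit [NeZero M] in
/-- Membership in the reversed axes of the inverse. [folklore] -/
theorem mem_inv_neg (j : Fin d) : j ∈ Θ.inv.neg ↔ Θ.perm j ∈ Θ.neg := by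
  simp only [inv, Finset.mem_map, Equiv.coe_toEmbedding]
  constructor
  · rintro ⟨k, hk, rfl⟩; simpa using hk
  · intro h; exact ⟨Θ.perm j, h, by simp⟩

omit [NeZero M] in
/-- `Θ⁻¹ ∘ Θ = id` on vectors. [folklore] -/
theorem inv_vec_vec (u : TorusSite d M) : Θ.inv.vec (Θ.vec u) = u := by
  funext j
  simp only [vec]
  have h1 : (Θ.inv).perm.symm j = Θ.perm j := by simp [inv]
  rw [h1, Equiv.symm_apply_apply]
  by_cases h : Θ.perm j ∈ Θ.neg
  · rw [if_pos ((mem_inv_neg Θ j).2 h), if_pos h]; ring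
  · rw [if_neg (fun h' => h ((mem_inv_neg Θ j).1 h')), if_neg h]; ring

omit [NeZero M] in
/-- `Θ ∘ Θ⁻¹ = id` on vectors. [folklore] -/
theorem vec_inv_vec (u : TorusSite d M) : Θ.vec (Θ.inv.vec u) = u := by
  funext j
  simp only [vec]
  have h1 : (Θ.inv).perm.symm (Θ.perm.symm j) = Θ.perm (Θ.perm.symm j) := by simp [inv]
  rw [h1, Equiv.apply_symm_apply]
  have h2 : Θ.perm.symm j ∈ Θ.inv.neg ↔ j ∈ Θ.neg := by rw [mem_inv_neg]; simp
  by_cases h : j ∈ Θ.neg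
  · rw [if_pos h, if_pos (h2.2 h)]; ring
  · rw [if_neg h, if_neg (fun h' => h (h2.1 h'))]; ring

/-- **The automorphism `E_Θ` of the torus fixing `a`**: `E y = a + Θ(y - a)`. [cite: BrydgesSlade2015RGII, §1.4 ("the subgroup of ℰ(Λ) consisting of automorphisms that fix the origin is homomorphic to the group Σ")] -/
def pt (a y : TorusSite d M) : TorusSite d M := a + Θ.vec (y - a)

omit [NeZero M] in
/-- `E` fixes `a`. [folklore] -/
@[simp] theorem pt_self (a : TorusSite d M) : Θ.pt a a = a := by simp [pt]

omit [NeZero M] in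
/-- `E(y + u) = E y + Θu` (`E` is affine). [folklore] -/
theorem pt_add (a y u : TorusSite d M) : Θ.pt a (y + u) = Θ.pt a y + Θ.vec u := by
  simp only [pt]
  rw [show y + u - a = (y - a) + u by abel, vec_add]
  abel

omit [NeZero M] in
/-- `E_{Θ⁻¹} ∘ E_Θ = id`. [folklore] -/
theorem inv_pt_pt (a y : TorusSite d M) : Θ.inv.pt a (Θ.pt a y) = y := by
  simp [pt, inv_vec_vec]

omit [NeZero M] in
/-- `E_Θ ∘ E_{Θ⁻¹} = id`. [folklore] -/
theorem pt_inv_pt (a y : TorusSite d M) : Θ.pt a (Θ.inv.pt a y) = y := by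
  simp [pt, vec_inv_vec]

/-- `E_Θ` as a permutation of the torus. [folklore] -/
def ptEquiv (a : TorusSite d M) : TorusSite d M ≃ TorusSite d M where
  toFun := Θ.pt a
  invFun := Θ.inv.pt a
  left_inv := Θ.inv_pt_pt a
  right_inv := Θ.pt_inv_pt a

/-- The action on unit steps: `Θ(±e_j) = ±'e_{πj}`. [folklore] -/
def step (s : Fin d × Bool) : Fin d × Bool := (Θ.perm s.1, if Θ.perm s.1 ∈ Θ.neg then !s.2 else s.2)

omit [NeZero M] in
/-- `Θ` maps unit steps to unit steps. [folklore] -/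
theorem vec_unitStep (s : Fin d × Bool) : Θ.vec (unitStep d M s) = unitStep d M (Θ.step s) := by
  obtain ⟨j₀, b⟩ := s
  funext j
  simp only [vec, unitStep, step]
  by_cases h : j = Θ.perm j₀
  · subst h
    simp only [Equiv.symm_apply_apply, Pi.single_eq_same]
    by_cases hn : Θ.perm j₀ ∈ Θ.neg <;> cases b <;> simp [hn]
  · have h' : Θ.perm.symm j ≠ j₀ := fun h'' => h (by rw [← h'', Equiv.apply_symm_apply])
    simp [h, h']

/-- The action on index sequences: relabel and re-sign every step. [folklore] -/
def onIdx (m'' : List (Fin n × List (Fin d × Bool))) : List (Fin n × List (Fin d × Bool)) :=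
  m''.map fun c => (c.1, c.2.map Θ.step)

/-- **The action `T_Θ φ = φ ∘ E_Θ` on fields** (`φ_E`), a continuous linear map. [cite: BrydgesSlade2015RGII, §1.4 ("(φ_E)_x = φ_{Ex}")] -/
def fieldMap (a : TorusSite d M) : (TorusSite d M → Fin n → ℝ) →L[ℝ] (TorusSite d M → Fin n → ℝ) :=
  { toFun := fun φ y => φ (Θ.pt a y)
    map_add' := fun _ _ => rfl
    map_smul' := fun _ _ => rfl
    cont := continuous_pi fun y => continuous_apply (Θ.pt a y) }

omit [NeZero M] in
/-- `(T_Θ φ)_y = φ_{E y}`. [folklore] -/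
@[simp] theorem fieldMap_apply (a : TorusSite d M) (φ : TorusSite d M → Fin n → ℝ) (y : TorusSite d M) :
    Θ.fieldMap a φ y = φ (Θ.pt a y) := rfl

/-- The induced permutation of the field labels: `(y, i) ↦ (E⁻¹ y, i)`. [folklore] -/
def labelPerm (a : TorusSite d M) : TorusSite d M × Fin n ≃ TorusSite d M × Fin n :=
  (Θ.ptEquiv a).symm.prodCongr (Equiv.refl (Fin n))

omit [NeZero M] in
/-- **`T_Θ` permutes the coordinate directions**: `T_Θ e_{(y,i)} = e_{(E⁻¹y, i)}`. [folklore] -/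
theorem isLabelPerm_fieldMap (a : TorusSite d M) : IsLabelPerm (n := n) (Θ.fieldMap a) (Θ.labelPerm a) := by
  intro ξ
  funext y i
  simp only [fieldMap_apply, basisDir_apply, labelPerm, Equiv.prodCongr_apply, Prod.map_fst, Prod.map_snd,
    Equiv.refl_apply]
  have h : (Θ.pt a y = ξ.1) ↔ (y = (Θ.ptEquiv a).symm ξ.1) := by
    rw [Equiv.eq_symm_apply]; rfl
  by_cases h1 : Θ.pt a y = ξ.1 ∧ i = ξ.2
  · rw [if_pos h1, if_pos ⟨h.1 h1.1, h1.2⟩]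
  · rw [if_neg h1, if_neg (fun h2 => h1 ⟨h.2 h2.1, h2.2⟩)]

/-! ### Covariance of the monomials and of `P̂` under `T_Θ` -/

/-- **`∇^α (φ_E)^i_x = (∇^{Θα} φ)^i_{Ex}`.** [folklore] -/
theorem dfield_fieldMap (a : TorusSite d M) (i : Fin n) (φ : TorusSite d M → Fin n → ℝ) :
    ∀ (l : List (Fin d × Bool)) (x : TorusSite d M),
    dfield l (x, i) (Θ.fieldMap a φ) = dfield (l.map Θ.step) (Θ.pt a x, i) φ
  | [], x => rfl
  | s :: l, x => by
      rw [List.map_cons, dfield_cons, dfield_cons, dfield_fieldMap a i φ l, dfield_fieldMap a i φ l, pt_add, vec_unitStep]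

/-- **`E M_{m,x} = M_{Θm, Ex}`**: the action of `E` on monomials re-signs and relabels the
derivatives and moves the point. [cite: BrydgesSlade2015RGII, §1.2 (display defining ΘM_m = M_{Θm}) and Proposition 1.4.3] -/
theorem monomial_comp_fieldMap (a : TorusSite d M) (m'' : List (Fin n × List (Fin d × Bool))) (x : TorusSite d M) :
    (fun φ => monomial m'' x (Θ.fieldMap a φ)) = monomial (Θ.onIdx m'') (Θ.pt a x) := by
  funext φ
  simp only [monomial, onIdx, List.map_map]
  congr 1
  exact List.map_congr_left fun c _ => by simp [Function.comp_apply, dfield_fieldMap]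

/-- Relabel the axes of an index sequence by `π` (no re-signing). [folklore] -/
def relabel (π : Equiv.Perm (Fin d)) (m'' : List (Fin n × List (Fin d × Bool))) : List (Fin n × List (Fin d × Bool)) :=
  m''.map fun c => (c.1, c.2.map fun s => (π s.1, s.2))

omit [NeZero M] in
/-- `Θ ∘ Θ_S = Θ_{πS Δ N} ∘ π` on index sequences. [folklore] -/
theorem onIdx_flipM (S : Finset (Fin d)) (m'' : List (Fin n × List (Fin d × Bool))) :
    Θ.onIdx (flipM S m'') = flipM (symmDiff (S.map Θ.perm.toEmbedding) Θ.neg) (relabel Θ.perm m'') := by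
  simp only [onIdx, flipM, relabel, List.map_map]
  refine List.map_congr_left fun c _ => ?_
  simp only [Function.comp_apply, flipL, List.map_map, Prod.mk.injEq, true_and]
  refine List.map_congr_left fun s _ => ?_
  have hmem : (Θ.perm s.1 ∈ S.map Θ.perm.toEmbedding) ↔ s.1 ∈ S := by
    rw [Finset.mem_map_equiv, Equiv.symm_apply_apply]
  simp only [Function.comp_apply, step, Finset.mem_symmDiff, hmem, Prod.mk.injEq, true_and]
  by_cases h1 : s.1 ∈ S <;> by_cases h2 : Θ.perm s.1 ∈ Θ.neg <;> cases s.2 <;> simp [h1, h2]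

omit [NeZero M] in
/-- Closed form of the sign of a flipped forward multi-index: `sgn(Θ_S α) = ∏_{j ∈ α} (-1)^{𝟙{j∈S}}`. [folklore] -/
theorem sgnB_flipL_fwd (S : Finset (Fin d)) (α : List (Fin d)) :
    sgnB (flipL S (α.map fun j => (j, true))) = (α.map fun j => if j ∈ S then (-1 : ℝ) else 1).prod := by
  simp only [sgnB, flipL, List.map_map]
  congr 1
  refine List.map_congr_left fun j _ => ?_
  by_cases h : j ∈ S <;> simp [h]

omit [NeZero M] in
/-- Closed form of `sgn(Θ_S m)` for forward `m`. [folklore] -/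
theorem sgnM_flipM_fwd (S : Finset (Fin d)) (m' : List (Fin n × List (Fin d))) :
    sgnM (flipM S (m'.map fwd)) = (m'.map fun c => (c.2.map fun j => if j ∈ S then (-1 : ℝ) else 1).prod).prod := by
  simp only [sgnM, flipM, List.map_map]
  congr 1
  refine List.map_congr_left fun c _ => ?_
  exact sgnB_flipL_fwd S c.2

omit [NeZero M] in
/-- The sign of a flipped forward sequence is multiplicative over symmetric differences:
`sgn(Θ_{AΔB}m) = sgn(Θ_A m)·sgn(Θ_B m)` for forward `m`. [folklore] -/
theorem sgnM_flipM_symmDiff (A B : Finset (Fin d)) (m' : List (Fin n × List (Fin d))) :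
    sgnM (flipM (symmDiff A B) (m'.map fwd)) = sgnM (flipM A (m'.map fwd)) * sgnM (flipM B (m'.map fwd)) := by
  rw [sgnM_flipM_fwd, sgnM_flipM_fwd, sgnM_flipM_fwd, ← List.prod_map_mul]
  congr 1
  refine List.map_congr_left fun c _ => ?_
  rw [← List.prod_map_mul]
  congr 1
  refine List.map_congr_left fun j _ => ?_
  simp only [Finset.mem_symmDiff]
  by_cases hA : j ∈ A <;> by_cases hB : j ∈ B <;> simp [hA, hB]

omit [NeZero M] in
/-- Relabelling does not change the sign: `sgn(Θ_{πS}(πm)) = sgn(Θ_S m)`. [folklore] -/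
theorem sgnM_flipM_relabel (π : Equiv.Perm (Fin d)) (S : Finset (Fin d)) (m' : List (Fin n × List (Fin d))) :
    sgnM (flipM (S.map π.toEmbedding) (relabel π (m'.map fwd))) = sgnM (flipM S (m'.map fwd)) := by
  have h : relabel π (m'.map fwd) = (m'.map fun c => (c.1, c.2.map π)).map fwd := by
    simp [relabel, fwd, List.map_map, Function.comp_def]
  rw [h, sgnM_flipM_fwd, sgnM_flipM_fwd, List.map_map]
  congr 1
  refine List.map_congr_left fun c _ => ?_
  simp only [Function.comp_apply, List.map_map]
  congr 1
  refine List.map_congr_left fun j _ => ?_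
  simp only [Function.comp_apply, Finset.mem_map_equiv, Equiv.symm_apply_apply]

/-- The forward representative with relabelled axes. [folklore] -/
def relabelF (π : Equiv.Perm (Fin d)) (m' : List (Fin n × List (Fin d))) : List (Fin n × List (Fin d)) :=
  m'.map fun c => (c.1, c.2.map π)

omit [NeZero M] in
/-- `relabel π (m'.map fwd) = (relabelF π m').map fwd`. [folklore] -/
theorem relabel_map_fwd (π : Equiv.Perm (Fin d)) (m' : List (Fin n × List (Fin d))) :
    relabel π (m'.map fwd) = (relabelF π m').map fwd := by
  simp [relabel, relabelF, fwd, List.map_map, Function.comp_def]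

/-- **Covariance of `P̂` (Definition 1.2.2 (i) and (iii) of [BS-rg-loc] for `P̂ = P(M)`)**:
`E P̂_{m,x} = λ(Θ, M_m) P̂_{πm, Ex}` with `λ = sgn(Θ_N(πm)) = (-1)^{#derivatives of πm along reversed axes}`
— `Σ_axes`-covariance (i) and `Σ_+`-equivariance (iii). [cite: BrydgesSlade2015RGII, Definition 1.2.2 (i),(iii) and the claim before it (proved in §2.3)] -/
theorem phat_comp_fieldMap (a : TorusSite d M) (m' : List (Fin n × List (Fin d))) (x : TorusSite d M) :
    (fun φ => phat m' x (Θ.fieldMap a φ)) =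
      fun φ => sgnM (flipM Θ.neg ((relabelF Θ.perm m').map fwd)) * phat (relabelF Θ.perm m') (Θ.pt a x) φ := by
  funext φ
  simp only [phat]
  have hmono : ∀ S : Finset (Fin d), monomial (flipM S (m'.map fwd)) x (Θ.fieldMap a φ) =
      monomial (flipM (symmDiff (S.map Θ.perm.toEmbedding) Θ.neg) ((relabelF Θ.perm m').map fwd)) (Θ.pt a x) φ := by
    intro S
    have h := congrFun (Θ.monomial_comp_fieldMap a (flipM S (m'.map fwd)) x) φ
    rw [h, onIdx_flipM, relabel_map_fwd]
  simp only [hmono]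
  -- reindex `S' = πS Δ N` on the right-hand side
  have hinv : Function.Involutive (fun S : Finset (Fin d) => symmDiff S Θ.neg) :=
    fun S => symmDiff_symmDiff_cancel_right Θ.neg S
  let e : Finset (Fin d) ≃ Finset (Fin d) := (Equiv.finsetCongr Θ.perm).trans (hinv.toPerm _)
  have he : ∀ S, e S = symmDiff (S.map Θ.perm.toEmbedding) Θ.neg := fun S => by
    simp [e, Equiv.finsetCongr_apply]
  rw [← Equiv.sum_comp e (fun S' => sgnM (flipM S' ((relabelF Θ.perm m').map fwd)) *
    monomial (flipM S' ((relabelF Θ.perm m').map fwd)) (Θ.pt a x) φ)]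
  simp only [he, Finset.mul_sum]
  refine Finset.sum_congr rfl fun S _ => ?_
  have hs := sgnM_mul_self (flipM Θ.neg ((relabelF Θ.perm m').map fwd))
  have hrel : sgnM (flipM (S.map Θ.perm.toEmbedding) ((relabelF Θ.perm m').map fwd)) = sgnM (flipM S (m'.map fwd)) := by
    rw [← relabel_map_fwd, sgnM_flipM_relabel]
  rw [sgnM_flipM_symmDiff (S.map Θ.perm.toEmbedding) Θ.neg (relabelF Θ.perm m'), hrel]
  set σN := sgnM (flipM Θ.neg ((relabelF Θ.perm m').map fwd))
  set X := monomial (flipM (symmDiff (S.map Θ.perm.toEmbedding) Θ.neg) ((relabelF Θ.perm m').map fwd)) (Θ.pt a x) φ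
  have h2 : σN * (((2 : ℝ) ^ d)⁻¹ * (sgnM (flipM S (m'.map fwd)) * σN * X)) =
      (σN * σN) * (((2 : ℝ) ^ d)⁻¹ * (sgnM (flipM S (m'.map fwd)) * X)) := by ring
  rw [h2, hs, one_mul]

end AxisSym

/-! ### Coordinates and binomial one-point functions under `E_Θ` -/

/-- In the patch, an element is not the antipode: `2|z| < M ⇒ 2·val ≠ M`. [folklore] -/
theorem two_mul_val_ne_of_abs_lt {x : ZMod M} (h : 2 * |x.valMinAbs| < M) : 2 * x.val ≠ M := by
  intro h2
  have hv : x.valMinAbs = x.val := by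
    rw [ZMod.valMinAbs_def_pos, if_pos (by omega)]
  rw [hv] at h
  have : (0 : ℤ) ≤ (x.val : ℤ) := by positivity
  rw [abs_of_nonneg this] at h
  omega

namespace AxisSym

variable (Θ : AxisSym d)

/-- **Coordinates under `E_Θ`**: `z_j(E y) = ± z_{π⁻¹j}(y)` inside the patch. [cite: BrydgesSlade2015RGII, §1.3 (coordinates are related by Euclidean automorphisms fixing the origin)] -/
theorem coord_pt (a y : TorusSite d M) (j : Fin d) (hy : 2 * |coord a y (Θ.perm.symm j)| < M) :
    coord a (Θ.pt a y) j = (if j ∈ Θ.neg then -1 else 1) * coord a y (Θ.perm.symm j) := by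
  unfold coord at hy ⊢
  have e : (Θ.pt a y) j - a j = (if j ∈ Θ.neg then -1 else 1) * (y (Θ.perm.symm j) - a (Θ.perm.symm j)) := by
    simp only [pt, vec, Pi.add_apply, Pi.sub_apply]
    ring
  rw [e]
  by_cases h : j ∈ Θ.neg
  · rw [if_pos h, if_pos h, neg_one_mul, neg_one_mul]
    exact ZMod.valMinAbs_neg_of_ne_half (two_mul_val_ne_of_abs_lt hy)
  · rw [if_neg h, if_neg h, one_mul, one_mul]

end AxisSym

/-- **The binomial of a negated argument in the binomial basis**:
`binom(-z, t) = Σ_{s ≤ t} (-1)^t binom(t-1, t-s) binom(z, s)` (from `binom(-z,t) = (-1)^t binom(z+t-1,t)`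
and Chu–Vandermonde). [folklore] -/
theorem choose_neg_eq_sum (z : ℤ) (t : ℕ) :
    ((Ring.choose (-z) t : ℤ) : ℝ) =
      ∑ s ∈ range (t + 1), (((-1 : ℤ) ^ t * Ring.choose ((t : ℤ) - 1) (t - s) : ℤ) : ℝ) * ((Ring.choose z s : ℤ) : ℝ) := by
  rw [Ring.choose_neg, Units.smul_def, Int.coe_negOnePow_natCast, smul_eq_mul,
    show z + (t : ℤ) - 1 = z + ((t : ℤ) - 1) by ring,
    Ring.add_choose_eq t (Commute.all _ _),
    ← Finset.Nat.sum_antidiagonal_eq_sum_range_succ (fun p q => (((-1 : ℤ) ^ t * Ring.choose ((t : ℤ) - 1) q : ℤ) : ℝ) * ((Ring.choose z p : ℤ) : ℝ))]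
  push_cast
  rw [Finset.mul_sum]
  refine Finset.sum_congr rfl fun pq _ => ?_
  ring

/-- The coefficients of `binom(εz, t)` in the binomial basis `binom(z, s)`: `δ_{s,t}` for `ε = 1`,
`(-1)^t binom(t-1,t-s)` for `ε = -1`. [folklore] -/
def signCoef (negated : Bool) (t s : ℕ) : ℝ :=
  if negated then (((-1 : ℤ) ^ t * Ring.choose ((t : ℤ) - 1) (t - s) : ℤ) : ℝ) else (if s = t then 1 else 0)

/-- `binom(εz, t) = Σ_{s ≤ t} signCoef(ε,t,s) binom(z,s)`. [folklore] -/
theorem choose_sign_eq_sum (negated : Bool) (z : ℤ) (t : ℕ) :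
    ((Ring.choose ((if negated then -1 else 1) * z) t : ℤ) : ℝ) =
      ∑ s ∈ range (t + 1), signCoef negated t s * ((Ring.choose z s : ℤ) : ℝ) := by
  cases negated
  · simp only [Bool.false_eq_true, if_false, one_mul, signCoef]
    rw [Finset.sum_eq_single t]
    · simp
    · intro s _ hs; simp [hs]
    · intro h; exact absurd (Finset.mem_range.2 (Nat.lt_succ_self t)) h
  · simp only [if_true, neg_one_mul, signCoef]
    exact choose_neg_eq_sum z t

namespace AxisSym

variable (Θ : AxisSym d)

/-- **The binomial one-point functions composed with `E_Θ` as expandable factors**: inside the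
patch, `b^{(a)}_{(i,t)} ∘ E = Σ_{s ≤ t∘π} (∏_k signCoef_k) b^{(a)}_{(i,s)}`. [folklore] -/
def axisFactor (a : TorusSite d M) (i : Fin n) (t : Fin d → ℕ) : ExpFactor d M n :=
  ⟨fun y => binomV a i t (Θ.pt a y.1, y.2), i, fun k => t (Θ.perm k),
    fun s => ∏ k : Fin d, signCoef (decide (Θ.perm k ∈ Θ.neg)) (t (Θ.perm k)) (s k)⟩

/-- Validity of the expansion of `b ∘ E` on the patch `U` (all coordinates `2|z_k| < M`). [folklore] -/
theorem axisFactor_valid (a : TorusSite d M) {U : Finset (TorusSite d M)} (hU : ∀ y ∈ U, ∀ k, 2 * |coord a y k| < M)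
    (i : Fin n) (t : Fin d → ℕ) : (Θ.axisFactor a i t).Valid a U := by
  intro y hy
  simp only [axisFactor, binomV]
  by_cases hi : y.2 = i
  · simp only [hi, if_true]
    -- reindex the product over the target axes `j = π k`
    rw [← Equiv.prod_comp Θ.perm (fun j => ((Ring.choose (coord a (Θ.pt a y.1) j) (t j) : ℤ) : ℝ))]
    have hfac : ∀ k, ((Ring.choose (coord a (Θ.pt a y.1) (Θ.perm k)) (t (Θ.perm k)) : ℤ) : ℝ) =
        ∑ s ∈ range (t (Θ.perm k) + 1), signCoef (decide (Θ.perm k ∈ Θ.neg)) (t (Θ.perm k)) s *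
          ((Ring.choose (coord a y.1 k) s : ℤ) : ℝ) := by
      intro k
      rw [Θ.coord_pt a y.1 (Θ.perm k) (by simpa using hU y.1 hy k), Equiv.symm_apply_apply,
        ← choose_sign_eq_sum]
      congr 3
      by_cases h : Θ.perm k ∈ Θ.neg <;> simp [h]
    simp only [hfac]
    rw [Finset.prod_univ_sum]
    refine Finset.sum_congr rfl fun s _ => ?_
    rw [Finset.prod_mul_distrib]
  · simp only [hi, if_false, mul_zero, Finset.sum_const_zero]

omit [NeZero M] in
/-- The weight of `b ∘ E` equals the weight of `b`. [folklore] -/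
theorem wtq_axisFactor (dφ : ℝ) (a : TorusSite d M) (i : Fin n) (t : Fin d → ℕ) :
    (Θ.axisFactor a i t).wtq dφ = dφ + ((∑ j, t j : ℕ) : ℝ) := by
  simp only [ExpFactor.wtq, axisFactor]
  congr 2
  exact Equiv.sum_comp Θ.perm t

end AxisSym

/-! ### The dual test functions pulled back by `E_Θ`; span stability -/

omit [NeZero M] in
/-- `(⊗L)_{f(w)} = (⊗(L ∘ f))_w`: mapping the letters of a sequence composes each factor. [folklore] -/
theorem tensorTF_map (f : TorusSite d M × Fin n → TorusSite d M × Fin n) :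
    ∀ (L : List (TorusSite d M × Fin n → ℝ)) (w : List (TorusSite d M × Fin n)),
    tensorTF L (w.map f) = tensorTF (L.map fun β => β ∘ f) w
  | [], [] => rfl
  | [], _ :: _ => rfl
  | _ :: _, [] => rfl
  | β :: L, y :: w => by
      rw [List.map_cons, List.map_cons, tensorTF_cons_cons, tensorTF_cons_cons, tensorTF_map f L w]
      rfl

namespace AxisSym

variable (Θ : AxisSym d)

omit [NeZero M] in
/-- The inverse label permutation is `(y,i) ↦ (E y, i)`. [folklore] -/
theorem labelPerm_symm_apply (a : TorusSite d M) (y : TorusSite d M × Fin n) :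
    (Θ.labelPerm a).symm y = (Θ.pt a y.1, y.2) := rfl

omit [NeZero M] in
/-- **`E^* f_C^{(a)}` is a product of expandable factors**: with `L = (rep C)` and the factors
`b_{c_k} ∘ E`, `f_C(E w) = N_C (⊗_k (b_{c_k} ∘ E))_w`. [folklore] -/
theorem dualC_comp_labelPerm (a : TorusSite d M) (C : Multiset (Fin n × Multiset (Fin d))) :
    (fun w : List (TorusSite d M × Fin n) => dualC a C (w.map (Θ.labelPerm (n := n) a).symm)) =
      fun w => ((((rep C).length.factorial : ℕ) : ℝ) / pcount (rep C) (rep C)) *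
        tensorTF (((rep C).map fun c => Θ.axisFactor a c.1 fun j => c.2.count j).map ExpFactor.β) w := by
  funext w
  unfold dualC dualTF
  congr 1
  have h : (w.map (Θ.labelPerm (n := n) a).symm) = w.map (fun y => (Θ.pt a y.1, y.2)) := rfl
  rw [h, tensorTF_map, List.map_map, List.map_map]
  rfl

/-- **Span stability under `E_Θ`**: an `H ∈ 𝒩(U)` (with `U` in the patch of `a`) whose pairings with
all `f_C^{(a)}`, `C ∈ 𝔳_+`, vanish also pairs to zero with all `E^* f_C^{(a)}` (the polynomial
test functions are mapped to polynomial test functions of the same dimension by `E^*`).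
[cite: BrydgesSlade2015RGII, Proposition 1.4.3 (proof: "E^* maps test functions in Π[EΛ'] to test functions in Π[Λ']")] -/
theorem TphiPairing_dualC_axis_eq_zero {pN : ℕ} {dφ dplus : ℝ} (hA : LocAdm M n pN dφ dplus)
    (a : TorusSite d M) {U : Finset (TorusSite d M)} (hU : ∀ y ∈ U, ∀ k, 2 * |coord a y k| < M)
    {H : (TorusSite d M → Fin n → ℝ) → ℝ} (hH : ContDiff ℝ ∞ H) (hHU : DependsOn U H)
    (hzero : ∀ C ∈ vPlus d n dφ dplus, TphiPairing pN (basisDir d M n) H 0 (dualC a C) = 0)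
    {C : Multiset (Fin n × Multiset (Fin d))} (hC : C ∈ vPlus d n dφ dplus) :
    TphiPairing pN (basisDir d M n) H 0 (fun w => dualC a C (w.map (Θ.labelPerm (n := n) a).symm)) = 0 := by
  set L₂ : List (ExpFactor d M n) := (rep C).map fun c => Θ.axisFactor a c.1 fun j => c.2.count j with hL₂
  have hdim : dim dφ (rep C) ≤ dplus := (mem_vbarPlus hA.pos).1 (rep_mem_vbarPlus hA.pos hC)
  have heq : (L₂.map (ExpFactor.wtq dφ)).sum = dim dφ (rep C) := by
    unfold dim
    rw [hL₂, List.map_map]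
    have h1 : ∀ l : List (Fin n × List (Fin d)),
        (l.map (ExpFactor.wtq dφ ∘ fun c => Θ.axisFactor a c.1 fun j => c.2.count j)).sum =
          (l.length : ℝ) * dφ + ((l.map fun c => c.2.length).sum : ℕ) := by
      intro l
      induction l with
      | nil => simp
      | cons c l ih =>
          simp only [List.map_cons, List.sum_cons, List.length_cons, Function.comp_apply] at ih ⊢
          rw [ih, wtq_axisFactor, sum_count_dir]
          push_cast
          ring
    exact h1 (rep C)
  have h0 : wt dφ ([] : List (Fin n × (Fin d → ℕ))) = 0 := by simp [wt]
  have hwt : wt dφ ([] : List (Fin n × (Fin d → ℕ))) + (L₂.map (ExpFactor.wtq dφ)).sum ≤ dplus := by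
    rw [h0, heq, zero_add]; exact hdim
  have hval : ∀ q ∈ L₂, q.Valid a U := by
    intro q hq
    rw [hL₂, List.mem_map] at hq
    obtain ⟨c, _, rfl⟩ := hq
    exact Θ.axisFactor_valid a hU c.1 _
  have h := TphiPairing_tensorTF_expand_eq_zero hA a hH hHU hzero L₂ [] hval hwt
  rw [List.map_nil, List.append_nil] at h
  rw [Θ.dualC_comp_labelPerm a C]
  unfold TphiPairing at h ⊢
  rw [pairing_smul_right, ← hL₂, h, mul_zero]

end AxisSym

/-! ### `P̂` depends on the index sequence only through its classes; relabelled classes -/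

/-- The signed class of a signed factor: component and multiset of signed steps. [folklore] -/
def sclass (c : Fin n × List (Fin d × Bool)) : Fin n × Multiset (Fin d × Bool) := (c.1, (c.2 : Multiset (Fin d × Bool)))

/-- Monomials depend on the factors only through their signed classes (order of factors and of
steps immaterial). [folklore] -/
theorem monomial_congr_sclass {m₁ m₂ : List (Fin n × List (Fin d × Bool))} (h : (m₁.map sclass).Perm (m₂.map sclass))
    (x : TorusSite d M) : monomial m₁ x = monomial m₂ x := by
  funext φ
  unfold monomial
  let g : Fin n × Multiset (Fin d × Bool) → ℝ := fun q => dfield q.2.toList (x, q.1) φ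
  have hg : ∀ m : List (Fin n × List (Fin d × Bool)), (m.map fun c => dfield c.2 (x, c.1) φ) = (m.map sclass).map g := by
    intro m
    rw [List.map_map]
    refine List.map_congr_left fun c _ => ?_
    simp only [Function.comp_apply, g, sclass]
    rw [dfield_perm (Multiset.coe_eq_coe.1 (by rw [Multiset.coe_toList]))]
  rw [hg m₁, hg m₂]
  exact (h.map g).prod_eq

omit [NeZero M] in
/-- The sign depends on the factors only through their signed classes. [folklore] -/
theorem sgnM_congr_sclass {m₁ m₂ : List (Fin n × List (Fin d × Bool))} (h : (m₁.map sclass).Perm (m₂.map sclass)) :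
    sgnM m₁ = sgnM m₂ := by
  unfold sgnM
  let g : Fin n × Multiset (Fin d × Bool) → ℝ := fun q => (q.2.map fun s => if s.2 then (1 : ℝ) else -1).prod
  have hg : ∀ m : List (Fin n × List (Fin d × Bool)), (m.map fun c => sgnB c.2) = (m.map sclass).map g := by
    intro m
    rw [List.map_map]
    refine List.map_congr_left fun c _ => ?_
    simp [Function.comp_apply, g, sclass, sgnB, Multiset.map_coe, Multiset.prod_coe]
  rw [hg m₁, hg m₂]
  exact (h.map g).prod_eq

omit [NeZero M] in
/-- The signed classes of a flipped forward sequence are determined by the classes. [folklore] -/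
theorem map_sclass_flipM_fwd (S : Finset (Fin d)) (m' : List (Fin n × List (Fin d))) :
    (flipM S (m'.map fwd)).map sclass =
      (m'.map cls).map fun q => (q.1, q.2.map fun j => (j, if j ∈ S then false else true)) := by
  simp only [flipM, flipL, List.map_map]
  refine List.map_congr_left fun c _ => ?_
  simp only [Function.comp_apply, sclass, fwd, cls, List.map_map, Multiset.map_coe, Prod.mk.injEq, true_and]
  congr 1

/-- **`P̂_{m,x}` depends on `m` only through the multiset of classes of its factors.** [folklore] -/
theorem phat_congr {m₁ m₂ : List (Fin n × List (Fin d))}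
    (h : ((m₁.map cls : List _) : Multiset (Fin n × Multiset (Fin d))) = (m₂.map cls : List _)) (x : TorusSite d M) :
    phat m₁ x = phat m₂ x := by
  have hp : (m₁.map cls).Perm (m₂.map cls) := Multiset.coe_eq_coe.1 h
  funext φ
  unfold phat
  congr 1
  refine Finset.sum_congr rfl fun S _ => ?_
  have hs : ((flipM S (m₁.map fwd)).map sclass).Perm ((flipM S (m₂.map fwd)).map sclass) := by
    rw [map_sclass_flipM_fwd, map_sclass_flipM_fwd]
    exact hp.map _
  rw [sgnM_congr_sclass hs, monomial_congr_sclass hs x]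

/-- `P̂_m(X)` depends on `m` only through the classes. [folklore] -/
theorem phatX_congr {m₁ m₂ : List (Fin n × List (Fin d))}
    (h : ((m₁.map cls : List _) : Multiset (Fin n × Multiset (Fin d))) = (m₂.map cls : List _)) (X : Finset (TorusSite d M)) :
    phatX m₁ X = phatX m₂ X := by
  unfold phatX; simp only [phat_congr h]

/-- Relabel the axes of a class. [folklore] -/
def relabelCls (π : Equiv.Perm (Fin d)) (C : Multiset (Fin n × Multiset (Fin d))) : Multiset (Fin n × Multiset (Fin d)) :=
  C.map fun q => (q.1, q.2.map π)

omit [NeZero M] in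
/-- The classes of a relabelled sequence. [folklore] -/
theorem map_cls_relabelF (π : Equiv.Perm (Fin d)) (m' : List (Fin n × List (Fin d))) :
    (((AxisSym.relabelF π m').map cls : List _) : Multiset (Fin n × Multiset (Fin d))) = relabelCls π ((m'.map cls : List _) : Multiset _) := by
  simp only [AxisSym.relabelF, relabelCls, List.map_map, ← Multiset.map_coe, Multiset.map_map]
  congr 1

omit [NeZero M] in
/-- Relabelling twice by inverse permutations is the identity. [folklore] -/
theorem relabelCls_symm_apply (π : Equiv.Perm (Fin d)) (C : Multiset (Fin n × Multiset (Fin d))) :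
    relabelCls π.symm (relabelCls π C) = C := by
  simp only [relabelCls, Multiset.map_map]
  conv_rhs => rw [← Multiset.map_id C]
  congr 1
  funext q
  simp [Function.comp_apply, Multiset.map_map]

omit [NeZero M] in
/-- The dimension is invariant under relabelling. [folklore] -/
theorem dim_relabelF (dφ : ℝ) (π : Equiv.Perm (Fin d)) (m' : List (Fin n × List (Fin d))) :
    dim dφ (AxisSym.relabelF π m') = dim dφ m' := by
  simp [dim, AxisSym.relabelF, List.map_map, Function.comp_def]

omit [NeZero M] in
/-- `𝔳_+` is invariant under relabelling of the axes. [folklore] -/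
theorem relabelCls_mem_vPlus {dφ dplus : ℝ} (hφ : 0 < dφ) (π : Equiv.Perm (Fin d))
    {C : Multiset (Fin n × Multiset (Fin d))} (hC : C ∈ vPlus d n dφ dplus) : relabelCls π C ∈ vPlus d n dφ dplus := by
  unfold vPlus at hC ⊢
  rw [Finset.mem_image] at hC ⊢
  obtain ⟨m, hm, rfl⟩ := hC
  refine ⟨AxisSym.relabelF π m, ?_, map_cls_relabelF π m⟩
  rw [mem_vbarPlus hφ] at hm ⊢
  rwa [dim_relabelF]

/-- **Relabelling as a permutation of `𝔳_+`.** [folklore] -/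
def relabelV {dφ dplus : ℝ} (hφ : 0 < dφ) (π : Equiv.Perm (Fin d)) : vPlus d n dφ dplus ≃ vPlus d n dφ dplus where
  toFun C := ⟨relabelCls π C.1, relabelCls_mem_vPlus hφ π C.2⟩
  invFun C := ⟨relabelCls π.symm C.1, relabelCls_mem_vPlus hφ π.symm C.2⟩
  left_inv C := Subtype.ext (relabelCls_symm_apply π C.1)
  right_inv C := Subtype.ext (by simpa using relabelCls_symm_apply π.symm C.1)

/-- `P̂_{πm}(Y) = P̂_{rep(π C)}(Y)` for the representative: relabelled representatives. [folklore] -/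
theorem phatX_relabelF_rep (π : Equiv.Perm (Fin d)) (C : Multiset (Fin n × Multiset (Fin d))) (Y : Finset (TorusSite d M)) :
    phatX (AxisSym.relabelF π (rep C)) Y = phatX (rep (relabelCls π C)) Y :=
  phatX_congr (by rw [map_cls_relabelF, cls_rep, cls_rep]) Y

/-! ### Proposition 1.4.3 (Euclidean covariance) and Proposition 1.4.4 for automorphisms fixing `a` -/

namespace AxisSym

variable (Θ : AxisSym d)

/-- `E(P̂_C(X)) = λ_C P̂_{πC}(EX)` for the class monomials, `λ_C = sgn(Θ_N(π rep C))`. [folklore] -/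
theorem phatX_rep_comp_fieldMap (a : TorusSite d M) (C : Multiset (Fin n × Multiset (Fin d))) (X : Finset (TorusSite d M)) :
    (fun φ => phatX (rep C) X (Θ.fieldMap a φ)) =
      fun φ => sgnM (flipM Θ.neg ((relabelF Θ.perm (rep C)).map fwd)) *
        phatX (rep (relabelCls Θ.perm C)) (X.image (Θ.pt a)) φ := by
  funext φ
  rw [← phatX_relabelF_rep]
  unfold phatX
  rw [Finset.sum_image (g := Θ.pt a) (f := fun x => phat (relabelF Θ.perm (rep C)) x φ)
    (fun x _ y _ h => (Θ.ptEquiv a).injective h), Finset.mul_sum]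
  refine Finset.sum_congr rfl fun x _ => ?_
  exact congrFun (Θ.phat_comp_fieldMap a (rep C) x) φ

/-- **Proposition 1.4.3 of [BS-rg-loc] (Euclidean covariance of `Loc`)** for the automorphisms
`E = E_Θ` fixing the base point `a`: `E(Loc_X F) = Loc_{EX}(EF)`, for `F ∈ 𝒩(U)` with `U` in
the patch of `a` containing the reach of `X` (translations: `…LocTranslation`). [cite: BrydgesSlade2015RGII, Proposition 1.4.3] -/
theorem locX_comp_fieldMap {pN : ℕ} {dφ dplus : ℝ} (hA : LocAdm M n pN dφ dplus) {a : TorusSite d M}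
    {X U : Finset (TorusSite d M)} (hXne : X.Nonempty) (hX : InPatch a ⌊dplus⌋₊ X)
    (hEX : InPatch a ⌊dplus⌋₊ (X.image (Θ.pt a)))
    (hU : ∀ y ∈ U, ∀ k, 2 * |coord a y k| < M) (hK : 2 * ((⌊dplus⌋₊ : ℤ) + 1) < M)
    (hXU : ∀ x ∈ X, reach x ⌊dplus⌋₊ ⊆ U)
    {F : (TorusSite d M → Fin n → ℝ) → ℝ} (hF : ContDiff ℝ ∞ F) (hFU : DependsOn U F) :
    (fun φ => locX pN dφ dplus a X F (Θ.fieldMap a φ)) =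
      locX pN dφ dplus a (X.image (Θ.pt a)) (fun φ => F (Θ.fieldMap a φ)) := by
  set V := locX pN dφ dplus a X F with hV
  have hVs : ContDiff ℝ ∞ V := contDiff_locX pN dφ dplus a X F
  have hVU : DependsOn U V := dependsOn_locX hA.pos hK hXU a F
  have hEXne : (X.image (Θ.pt a)).Nonempty := hXne.image _
  -- (A) `V ∘ T ∈ 𝒱(EX)`: reindex the classes by `C ↦ πC`
  set rv := relabelV (n := n) (dplus := dplus) hA.pos Θ.perm with hrv
  set β := betaVec pN dφ dplus a X F with hβ
  set γ : vPlus d n dφ dplus → ℝ := fun C' =>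
    β (rv.symm C') * sgnM (flipM Θ.neg ((relabelF Θ.perm (rep (rv.symm C').1)).map fwd)) with hγ
  have hA' : (fun φ => V (Θ.fieldMap a φ)) = fun φ => ∑ C' : vPlus d n dφ dplus, γ C' * phatX (rep C'.1) (X.image (Θ.pt a)) φ := by
    funext φ
    rw [hV]
    unfold locX
    rw [← hβ]
    rw [← Equiv.sum_comp rv.symm]
    refine Finset.sum_congr rfl fun C' _ => ?_
    have h := congrFun (Θ.phatX_rep_comp_fieldMap a (rv.symm C').1 X) φ
    rw [h, hγ]
    have hC : relabelCls Θ.perm (rv.symm C').1 = C'.1 := by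
      have := rv.apply_symm_apply C'
      rw [hrv] at this
      exact congrArg Subtype.val this
    rw [hC]
    ring
  -- (B) the defining pairings: `⟨V∘T, f_C'⟩ = ⟨F∘T, f_C'⟩`
  have hzero : ∀ C ∈ vPlus d n dφ dplus,
      TphiPairing pN (basisDir d M n) (fun ψ => V ψ - F ψ) 0 (dualC a C) = 0 := by
    intro C hC
    rw [TphiPairing_sub pN _ hVs hF]
    have := TphiPairing_locX_dualC hA hX hXne F ⟨C, hC⟩
    rw [hV]; simp only [] at this ⊢; linarith
  have hpair : ∀ C' : vPlus d n dφ dplus,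
      TphiPairing pN (basisDir d M n) (fun φ => V (Θ.fieldMap a φ)) 0 (dualC a C'.1) =
        TphiPairing pN (basisDir d M n) (fun φ => F (Θ.fieldMap a φ)) 0 (dualC a C'.1) := by
    intro C'
    rw [TphiPairing_comp_labelPerm_zero pN (Θ.isLabelPerm_fieldMap a) hVs,
      TphiPairing_comp_labelPerm_zero pN (Θ.isLabelPerm_fieldMap a) hF]
    have h := Θ.TphiPairing_dualC_axis_eq_zero hA a hU (hVs.sub hF)
      (fun φ ψ h => by simp only []; rw [hVU φ ψ h, hFU φ ψ h]) hzero C'.2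
    rw [TphiPairing_sub pN _ hVs hF] at h
    linarith
  -- (C) uniqueness at `(a, EX)`
  have hα : alphaVec pN dφ dplus a (fun φ => V (Θ.fieldMap a φ)) = alphaVec (n := n) pN dφ dplus a (fun φ => F (Θ.fieldMap a φ)) :=
    funext hpair
  rw [← locX_congr_of_alphaVec_eq pN dφ dplus a (X.image (Θ.pt a)) hα, hA']
  exact (locX_sum_phatX hA hEX hEXne γ).symm

/-- **Proposition 1.4.4 of [BS-rg-loc]** for an automorphism `E = E_Θ ∈ ℰ(X)` fixing `a`: if
`EF = F` and `EX = X` then the polynomial `P ∈ 𝒱` with `P(X) = Loc_X F` obeys `Θ_E P = P`, i.e.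
its coefficients satisfy `β_{πC}·1 = λ_C β_C` (`λ_C = ±1` the covariance sign of `P̂_C`). [cite: BrydgesSlade2015RGII, Proposition 1.4.4] -/
theorem betaVec_relabel_of_invariant {pN : ℕ} {dφ dplus : ℝ} (hA : LocAdm M n pN dφ dplus) {a : TorusSite d M}
    {X U : Finset (TorusSite d M)} (hXne : X.Nonempty) (hX : InPatch a ⌊dplus⌋₊ X)
    (hEX : X.image (Θ.pt a) = X)
    (hU : ∀ y ∈ U, ∀ k, 2 * |coord a y k| < M) (hK : 2 * ((⌊dplus⌋₊ : ℤ) + 1) < M)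
    (hXU : ∀ x ∈ X, reach x ⌊dplus⌋₊ ⊆ U)
    {F : (TorusSite d M → Fin n → ℝ) → ℝ} (hF : ContDiff ℝ ∞ F) (hFU : DependsOn U F)
    (hEF : (fun φ => F (Θ.fieldMap a φ)) = F) (C : vPlus d n dφ dplus) :
    betaVec pN dφ dplus a X F (relabelV hA.pos Θ.perm C) =
      sgnM (flipM Θ.neg ((relabelF Θ.perm (rep C.1)).map fwd)) * betaVec pN dφ dplus a X F C := by
  have hcov := Θ.locX_comp_fieldMap hA hXne hX (by rw [hEX]; exact hX) hU hK hXU hF hFU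
  rw [hEX, hEF] at hcov
  -- both sides are expansions in the basis `P̂_{C'}(X)`; compare coefficients
  set rv := relabelV (n := n) (dplus := dplus) hA.pos Θ.perm with hrv
  set β := betaVec pN dφ dplus a X F with hβ
  set γ : vPlus d n dφ dplus → ℝ := fun C' =>
    β (rv.symm C') * sgnM (flipM Θ.neg ((relabelF Θ.perm (rep (rv.symm C').1)).map fwd)) with hγ
  have hlhs : (fun φ => locX pN dφ dplus a X F (Θ.fieldMap a φ)) =
      fun φ => ∑ C' : vPlus d n dφ dplus, γ C' * phatX (rep C'.1) X φ := by
    funext φ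
    unfold locX
    rw [← hβ, ← Equiv.sum_comp rv.symm]
    refine Finset.sum_congr rfl fun C' _ => ?_
    have h := congrFun (Θ.phatX_rep_comp_fieldMap a (rv.symm C').1 X) φ
    rw [h, hEX, hγ]
    have hC : relabelCls Θ.perm (rv.symm C').1 = C'.1 := by
      have := rv.apply_symm_apply C'
      rw [hrv] at this
      exact congrArg Subtype.val this
    rw [hC]
    ring
  have hrhs : locX pN dφ dplus a X F = fun φ => ∑ C' : vPlus d n dφ dplus, β C' * phatX (rep C'.1) X φ := rfl
  rw [hlhs, hrhs] at hcov
  -- uniqueness of the coefficients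
  have hdiff : (fun C' => γ C' - β C') = 0 := by
    refine eq_zero_of_TphiPairing_dualC_eq_zero hA hX hXne _ fun C'' => ?_
    have h1 : (fun φ => ∑ C' : vPlus d n dφ dplus, (γ C' - β C') * phatX (rep C'.1) X φ) =
        fun φ => (∑ C' : vPlus d n dφ dplus, γ C' * phatX (rep C'.1) X φ) - ∑ C' : vPlus d n dφ dplus, β C' * phatX (rep C'.1) X φ := by
      funext φ; simp only [sub_mul, Finset.sum_sub_distrib]
    rw [h1, TphiPairing_sub pN _ (ContDiff.sum fun C' _ => contDiff_const.mul (contDiff_phatX _ X))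
      (ContDiff.sum fun C' _ => contDiff_const.mul (contDiff_phatX _ X)), hcov, sub_self]
  have hC0 := congrFun hdiff (rv C)
  simp only [Pi.zero_apply, sub_eq_zero] at hC0
  rw [← hC0, hγ]
  simp only [Equiv.symm_apply_apply]
  rw [mul_comm]

end AxisSym

end Loc

end LongRangePhi4

end Literature.Barriers.CriticalPhenomena

end
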